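import Summits.Ventures.PercRepro.RankLevelSetNullitySplitK

/-!
# PercRepro — THE NULLITY SPLIT, THE BRANCH COUNTS REFINED: the `U`-side through the closure of `X` and the spanning
sets through the coindependence bound (p8, gen 24; a feeder for S4 — the giant band `(p, d ≈ 70)` of the rows
`≤ 37` of the `q = 7` window)

In the branch «some set `X` of rank `≤ 7` has nullity `≥ d − i`» of the `k`-step split (RankLevelSetNullitySplitK), the
`U`-side `#U(p, 7) ≤ (Σ_{j ≤ i} C(n, j))·2^{|X|}` pays `2^{|X|}` for every small set `J` outside `X`; but a counted set
`S = E ∖ A` of rank `7` with `S ⊄ cl(X)` has `r(S ∩ X) ≤ 6` (else `S ⊆ cl(S ∩ X) ⊆ cl(X)`), so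
**`#U(p, 7) ≤ 2^{|cl X|} + #{Y ⊆ X : r(Y) ≤ 6}·Σ_{j ≤ i} C(n, j)`** (`topCount_le_two_pow_add_of_nullity_ge`), with
`#{Y ⊆ X : r(Y) ≤ 6} ≤ min (2^{|X|}) #{Y ⊆ E : r(Y) ≤ 6}` — at `(36, 75)` the old bound is `14` budgets, the new one
`5·10⁻⁴`. And the spanning sets: `A` spanning means `E ∖ A` coindependent, so `|(E ∖ A) ∖ X| ≤ i` and
**`#{spanning} ≤ (Σ_{j ≤ i} C(n, j))·2^{|X|}`** (`ncard_spanning_le_of_nullity_ge`) — instead of the crude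
`Σ_{j ≤ d} C(n, j)`, which is `0.9999·2^n` in the giant band. Axioms: standard.
-/

open scoped Matroid

namespace PercRepro

namespace ThmN

open Set

variable {α : Type}

/-- **The spanning count when a set `X` has nullity `≥ d − i`**: `#{A : r(A) = r(E)} ≤ (Σ_{j ≤ i} C(n, j))·2^{|X|}` — the
complement of a spanning set is coindependent, so it has `≤ i` points off `X` (`ncard_sdiff_add_ncard_le_of_coindep`), and
`A ↦ ((E ∖ A) ∩ X, (E ∖ A) ∖ X)` injects into `𝒫(X) × {J : |J| ≤ i}`. -/
theorem ncard_spanning_le_of_nullity_ge (M : Matroid α) [M.Finite] {d i : ℕ}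
    (hd : M.E.encard = M.eRank + d) {X : Set α} (hX : X ⊆ M.E)
    (hnul : M.eRk X + d ≤ (X.ncard : ℕ∞) + i) :
    {A : Set α | A ⊆ M.E ∧ M.eRk A = M.eRank}.ncard ≤
      (∑ j ∈ Finset.range (i + 1), M.E.ncard.choose j) * 2 ^ X.ncard := by
  classical
  have hXfin : X.Finite := M.ground_finite.subset hX
  set T := {A : Set α | A ⊆ M.E ∧ M.eRk A = M.eRank} with hT
  set J := {J : Set α | J ⊆ M.E ∧ J.ncard ≤ i} with hJ
  have hJfin : J.Finite := M.ground_finite.finite_subsets.subset fun J hJ => hJ.1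
  have hmaps : ∀ A ∈ T, ((M.E \ A) ∩ X, (M.E \ A) \ X) ∈ (𝒫 X) ×ˢ J := by
    intro A hA
    refine ⟨Set.inter_subset_right, Set.sdiff_subset.trans Set.sdiff_subset, ?_⟩
    have hsp : M.Spanning A := by
      rw [Matroid.spanning_iff_eRk_le']
      exact ⟨by rw [hA.2], hA.1⟩
    have hco : M.Coindep (M.E \ A) := by
      rw [Matroid.coindep_iff_compl_spanning Set.sdiff_subset, Set.sdiff_sdiff_cancel_left hA.1]
      exact hsp
    have h := ncard_sdiff_add_ncard_le_of_coindep M hd hco hX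
    have hne : M.eRk X ≠ ⊤ := ((M.eRk_le_encard _).trans_lt hXfin.encard_lt_top).ne
    obtain ⟨r, hr⟩ := ENat.ne_top_iff_exists.1 hne
    rw [← hr] at h hnul
    have e1 : ((M.E \ A) \ X).ncard + X.ncard ≤ r + d := by exact_mod_cast h
    have e2 : r + d ≤ X.ncard + i := by exact_mod_cast hnul
    show ((M.E \ A) \ X).ncard ≤ i
    omega
  have hinj : Set.InjOn (fun A => ((M.E \ A) ∩ X, (M.E \ A) \ X)) T := by
    intro A hA A' hA' h
    simp only [Prod.mk.injEq] at h
    have h1 : M.E \ A = M.E \ A' := by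
      rw [← Set.inter_union_sdiff (M.E \ A) X, ← Set.inter_union_sdiff (M.E \ A') X, h.1, h.2]
    rw [← Set.sdiff_sdiff_cancel_left hA.1, h1, Set.sdiff_sdiff_cancel_left hA'.1]
  have hcard := Set.ncard_le_ncard_of_injOn (fun A => ((M.E \ A) ∩ X, (M.E \ A) \ X)) hmaps hinj
    (hXfin.powerset.prod hJfin)
  rw [Set.ncard_prod, Set.ncard_powerset X hXfin] at hcard
  calc T.ncard ≤ 2 ^ X.ncard * J.ncard := hcard
    _ ≤ 2 ^ X.ncard * ∑ j ∈ Finset.range (i + 1), M.E.ncard.choose j :=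
        Nat.mul_le_mul_left _ (ncard_subsets_card_le_le M.E M.ground_finite i)
    _ = (∑ j ∈ Finset.range (i + 1), M.E.ncard.choose j) * 2 ^ X.ncard := by ring

/-- **The top count through the closure of `X`**: if `X ⊆ E` has nullity `≥ d − i`, then
`#U(p, 7) ≤ 2^{|cl X|} + #{Y ⊆ X : r(Y) ≤ 6}·Σ_{j ≤ i} C(n, j)`: a counted set `S = E ∖ A` of rank `7` either lies in
`cl(X)`, or has `r(S ∩ X) ≤ 6` (a rank-`7` part would put `S ⊆ cl(S ∩ X) ⊆ cl X`) and at most `i` points off `X`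
(coindependence). With `#{Y ⊆ X : r(Y) ≤ 6} ≤ min (2^{|X|}) B` for any bound `B` on the rank-`≤ 6` subsets of `E`. -/
theorem topCount_le_two_pow_add_of_nullity_ge (M : Matroid α) [M.Finite] {p d i : ℕ}
    (hR : M.eRank = (p : ℕ∞)) (hd : M.E.encard = M.eRank + d) {X : Set α} (hX : X ⊆ M.E)
    (hnul : M.eRk X + d ≤ (X.ncard : ℕ∞) + i) {f B : ℕ} (hf : (M.closure X).ncard ≤ f)
    (hB : {Y : Set α | Y ⊆ M.E ∧ M.eRk Y ≤ 6}.ncard ≤ B) :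
    Matroid.topCount M p 7 ≤ 2 ^ f + min (2 ^ X.ncard) B * ∑ j ∈ Finset.range (i + 1), M.E.ncard.choose j := by
  classical
  have hXfin : X.Finite := M.ground_finite.subset hX
  have hclE : M.closure X ⊆ M.E := M.closure_subset_ground X
  have hclfin : (M.closure X).Finite := M.ground_finite.subset hclE
  unfold Matroid.topCount
  set T := {A : Set α | A ⊆ M.E ∧ M.eRk A = (p : ℕ∞) ∧ M.eRk (M.E \ A) = ((7 : ℕ) : ℕ∞)} with hT
  set T₁ := {A : Set α | A ∈ T ∧ M.E \ A ⊆ M.closure X} with hT₁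
  set T₂ := {A : Set α | A ∈ T ∧ ¬ (M.E \ A ⊆ M.closure X)} with hT₂
  have hTfin : T.Finite := M.ground_finite.finite_subsets.subset fun A hA => hA.1
  have hT₁fin : T₁.Finite := hTfin.subset fun A hA => hA.1
  have hT₂fin : T₂.Finite := hTfin.subset fun A hA => hA.1
  have hsplit : T ⊆ T₁ ∪ T₂ := by
    intro A hA
    by_cases h : M.E \ A ⊆ M.closure X
    · exact Or.inl ⟨hA, h⟩
    · exact Or.inr ⟨hA, h⟩
  -- `T₁`: the complements lie in `cl X`
  have hT₁card : T₁.ncard ≤ 2 ^ f := by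
    have hmaps : ∀ A ∈ T₁, M.E \ A ∈ 𝒫 (M.closure X) := fun A hA => hA.2
    have hinj : Set.InjOn (fun A => M.E \ A) T₁ := by
      intro A hA A' hA' h
      simp only at h
      rw [← Set.sdiff_sdiff_cancel_left hA.1.1, h, Set.sdiff_sdiff_cancel_left hA'.1.1]
    have h := Set.ncard_le_ncard_of_injOn (fun A => M.E \ A) hmaps hinj hclfin.powerset
    rw [Set.ncard_powerset _ hclfin] at h
    exact h.trans (Nat.pow_le_pow_right (by norm_num) hf)
  -- `T₂`: the part inside `X` has rank `≤ 6`, the part outside has `≤ i` points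
  set Y₆ := {Y : Set α | Y ⊆ X ∧ M.eRk Y ≤ 6} with hY₆
  set J := {J : Set α | J ⊆ M.E ∧ J.ncard ≤ i} with hJ
  have hY₆fin : Y₆.Finite := hXfin.finite_subsets.subset fun Y hY => hY.1
  have hJfin : J.Finite := M.ground_finite.finite_subsets.subset fun J hJ => hJ.1
  have hmaps : ∀ A ∈ T₂, ((M.E \ A) ∩ X, (M.E \ A) \ X) ∈ Y₆ ×ˢ J := by
    intro A hA
    obtain ⟨hAT, hnot⟩ := hA
    refine ⟨⟨Set.inter_subset_right, ?_⟩, Set.sdiff_subset.trans Set.sdiff_subset, ?_⟩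
    · -- the rank of `(E ∖ A) ∩ X` is `≤ 6`
      by_contra hgt
      push Not at hgt
      have hS7 : M.eRk (M.E \ A) = 7 := hAT.2.2
      have h7 : (7 : ℕ∞) ≤ M.eRk ((M.E \ A) ∩ X) := Order.add_one_le_of_lt hgt
      have hle : M.eRk (M.E \ A) ≤ M.eRk ((M.E \ A) ∩ X) := by rw [hS7]; exact h7
      have hfin : M.IsRkFinite ((M.E \ A) ∩ X) := by
        rw [← Matroid.eRk_ne_top_iff]
        exact ((M.eRk_le_encard _).trans_lt
          (M.ground_finite.subset (Set.inter_subset_left.trans Set.sdiff_subset)).encard_lt_top).ne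
      have hcl := hfin.closure_eq_closure_of_subset_of_eRk_ge_eRk Set.inter_subset_left hle
      apply hnot
      calc M.E \ A ⊆ M.closure (M.E \ A) := M.subset_closure _ Set.sdiff_subset
        _ = M.closure ((M.E \ A) ∩ X) := hcl.symm
        _ ⊆ M.closure X := M.closure_subset_closure Set.inter_subset_right
    · -- at most `i` points off `X`: coindependence
      have hsp : M.Spanning A := by
        rw [Matroid.spanning_iff_eRk_le']
        exact ⟨by rw [hR, hAT.2.1], hAT.1⟩
      have hco : M.Coindep (M.E \ A) := by
        rw [Matroid.coindep_iff_compl_spanning Set.sdiff_subset, Set.sdiff_sdiff_cancel_left hAT.1]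
        exact hsp
      have h := ncard_sdiff_add_ncard_le_of_coindep M hd hco hX
      have hne : M.eRk X ≠ ⊤ := ((M.eRk_le_encard _).trans_lt hXfin.encard_lt_top).ne
      obtain ⟨r, hr⟩ := ENat.ne_top_iff_exists.1 hne
      rw [← hr] at h hnul
      have e1 : ((M.E \ A) \ X).ncard + X.ncard ≤ r + d := by exact_mod_cast h
      have e2 : r + d ≤ X.ncard + i := by exact_mod_cast hnul
      show ((M.E \ A) \ X).ncard ≤ i
      omega
  have hinj : Set.InjOn (fun A => ((M.E \ A) ∩ X, (M.E \ A) \ X)) T₂ := by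
    intro A hA A' hA' h
    simp only [Prod.mk.injEq] at h
    have h1 : M.E \ A = M.E \ A' := by
      rw [← Set.inter_union_sdiff (M.E \ A) X, ← Set.inter_union_sdiff (M.E \ A') X, h.1, h.2]
    rw [← Set.sdiff_sdiff_cancel_left hA.1.1, h1, Set.sdiff_sdiff_cancel_left hA'.1.1]
  have hT₂card : T₂.ncard ≤ min (2 ^ X.ncard) B * ∑ j ∈ Finset.range (i + 1), M.E.ncard.choose j := by
    have hcard := Set.ncard_le_ncard_of_injOn (fun A => ((M.E \ A) ∩ X, (M.E \ A) \ X)) hmaps hinj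
      (hY₆fin.prod hJfin)
    rw [Set.ncard_prod] at hcard
    have hY₆a : Y₆.ncard ≤ 2 ^ X.ncard := by
      have := Set.ncard_le_ncard (show Y₆ ⊆ 𝒫 X from fun Y hY => hY.1) hXfin.powerset
      rwa [Set.ncard_powerset _ hXfin] at this
    have hY₆b : Y₆.ncard ≤ B := by
      refine (Set.ncard_le_ncard (show Y₆ ⊆ {Y : Set α | Y ⊆ M.E ∧ M.eRk Y ≤ 6} from
        fun Y hY => ⟨hY.1.trans hX, hY.2⟩)
        (M.ground_finite.finite_subsets.subset fun Y hY => hY.1)).trans hB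
    calc T₂.ncard ≤ Y₆.ncard * J.ncard := hcard
      _ ≤ min (2 ^ X.ncard) B * ∑ j ∈ Finset.range (i + 1), M.E.ncard.choose j :=
          Nat.mul_le_mul (le_min hY₆a hY₆b) (ncard_subsets_card_le_le M.E M.ground_finite i)
  calc T.ncard ≤ (T₁ ∪ T₂).ncard := Set.ncard_le_ncard hsplit (hT₁fin.union hT₂fin)
    _ ≤ T₁.ncard + T₂.ncard := Set.ncard_union_le _ _
    _ ≤ 2 ^ f + min (2 ^ X.ncard) B * ∑ j ∈ Finset.range (i + 1), M.E.ncard.choose j :=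
        Nat.add_le_add hT₁card hT₂card

end ThmN

end PercRepro
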